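import Literature.ComputerArithmetic.RumpOgitaOishi2008.NextPowerTwo

/-!
# Rump–Ogita–Oishi 2008: Algorithm 4.4 — the final version of `Transform` (check for zero, `M` and
# `σ₀` by `NextPowerTwo`) — and `AccSum` (Algorithm 4.5) over it: Lemma 4.2, Lemma 4.3,
# Proposition 4.6 and Corollary 4.7 for the final version

HONEST FRAMING (ENGINES group, unit `eng-quad-4`, kernels lane of the `certquad` engine — shared
numerical engines serving client cells; rigour lives in the verifiers; every published number
belongs to a client cell's ledger, not to the engines group): the one algorithm of Part I of the
accurate-summation papers that `AccSum` (its NOTE (d)) and `NextPowerTwo` left untyped, typed and PROVED at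
FORMAT LEVEL — over the tree's binary floating-point numbers `JeannerodRump2018.IsFloat p emin` (precision `p`,
gradual underflow from `emin`, NO overflow) and round-to-nearest maps `JeannerodRump2018.IsRoundNearest p emin fl`;
IEEE 754 rounding to nearest TIES TO EVEN is the tree's `BoldoJeannerodMelquiondMuller2023.roundTiesEven p emin`:
* ALGORITHM 4.4, the FINAL version of `Transform` — `M = NextPowerTwo(length(p) + 2)` (i.e. `2ᴹ`) and
  `σ₀ = 2ᴹ·NextPowerTwo(μ)` computed by Algorithm 3.6 "so that only basic floating-point operations are
  necessary", and the CHECK FOR ZERO `if t′ = 0, [τ₁, τ₂, p, σ] = Transform(p); return` (the recursive restart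
  on the vector of remaining parts) — with ALGORITHM 4.5 `AccSum` over it, i.e. the algorithm of the source's
  executable Algorithm 6.1 ("AccSum including check for zero sum");
* LEMMA 4.2 and LEMMA 4.3 for Algorithm 4.4 ("the assertions of Lemmas 4.2 and 4.3 remain true for both
  Algorithms 4.1 and 4.4"), PROPOSITION 4.6 (`res` is a faithful rounding of `s = Σ pᵢ`) and COROLLARY 4.7 for
  this final version — for EVERY rounding to nearest under the hypothesis `(2ᴹ)²eps ≤ 1` on the COMPUTED `2ᴹ`,
  and in IEEE 754 arithmetic (ties to even, `emin ≤ 0`) under exactly the printed hypothesis `2²ᴹeps ≤ 1`,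
  `M = ⌈log₂(n + 2)⌉` (Theorem 3.7 makes the computed `2ᴹ` equal to `2^⌈log₂(n+2)⌉`).
No hardware, vendor, timing, flop-count or IEEE-format claims: `p` and `emin` are parameters.

Source read at the page: [RumpOgitaOishi2008] S. M. Rump, T. Ogita, S. Oishi, *Accurate floating-point
summation part I: faithful rounding*, SIAM J. Sci. Comput. 31(1) (2008) 189–224, doi:10.1137/050645671;
read in the authors' version (33 pp.; its page numbers are used): p. 4 (`F`, `eps`, `eta`, eq. (2.3)
`fl(a + b) = 0 ⟺ a = −b`), p. 14 (Algorithm 3.6 `NextPowerTwo`, Theorem 3.7 and the Remark), p. 15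
(Algorithm 4.1, Remark 2, Lemma 4.2, eqs. (4.2)–(4.5)), p. 17 (Lemma 4.3, eqs. (4.9)–(4.12)), p. 21 (the check
for zero: "A simpler way is to test for `t⁽ᵐ⁾ = 0`. In that case `t⁽ᵐ⁾ = fl(t⁽ᵐ⁻¹⁾ + τ⁽ᵐ⁾) = 0 = t⁽ᵐ⁻¹⁾ + τ⁽ᵐ⁾`
because of (2.3), so (4.2) implies `s = Σ p⁽ᵐ⁾ᵢ`. Hence, we can apply Algorithm Transform recursively to the
extracted vector `p⁽ᵐ⁾ᵢ` of lower order parts"; ALGORITHM 4.4; "the results of Algorithms 4.1 and 4.4 might be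
different (although always faithful) since in the recursive call of Transform, `μ` and `σ` are computed afresh.
Nevertheless, the assertions of Lemmas 4.2 and 4.3 remain true for both Algorithms 4.1 and 4.4";
ALGORITHM 4.5; PROPOSITION 4.6 with proof), p. 22 (COROLLARY 4.7, eq. (4.24), with proof), pp. 30–31
(Appendix, ALGORITHM 6.1, the executable Matlab code: "the variable `Ms` refers to `2ᴹ`";
`Ms = NextPowerTwo(n+2); % n+2 <= 2^M = Ms`, `sigma = Ms*NextPowerTwo(mu);`, `phi = 2^(-53)*Ms;`,
`factor = 2^(-53)*Ms*Ms;`, `if ( abs(tau1)>=factor*sigma ) | ( sigma<=realmin )`, `if t==0 … res = AccSum(p);`).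

DICTIONARY (source ↦ here; carriers `ℚ`; the dictionaries of `ExtractVector`, `AccSum` and `NextPowerTwo` —
`F ↦ IsFloat p emin`, `fl ↦ IsRoundNearest p emin fl`, `eps ↦ unitRoundoff p = 2^-p`, `eta ↦ 2^emin`,
`½eps⁻¹eta ↦ 2^(emin+p-1)`, `ufp`, `gℤ ↦ OnGrid g`, `μ = max |pᵢ| ↦ maxAbs xs`, `ExtractVector ↦ extractVector`,
`FastTwoSum ↦ fast2Sum`, `NextPowerTwo ↦ nextPowerTwo fl p`, the assertions (4.2)–(4.5) of Lemma 4.2 ↦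
`TransformSpec p emin fl M s n τ₁ τ₂ p′ σ`, `fl(Σ p′ᵢ) ↦ flSum fl p′` / `SumTree.eval` — continue).
* the input vector `p` ↦ `xs : List ℚ` (`p` is the precision here), `n = length(p) ↦ xs.length`.
* `2ᴹ`, where `M = NextPowerTwo(length(p) + 2)` — Algorithm 6.1's `Ms` — ↦ `twoPowM fl p xs =
  nextPowerTwo fl p (n + 2)`: a power of two `2^M'` with `n + 2 ≤ 2^M'`, `M' ∈ {⌈log₂(n+2)⌉, ⌈log₂(n+2)⌉ + 1}`
  (`twoPowM_eq`; `= 2^⌈log₂(n+2)⌉` under ties to even, `twoPowM_roundTiesEven`); `2ᴹepsσ`, `2²ᴹepsσ`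
  (6.1: `phi*sigma`, `factor*sigma`) ↦ `fl (Ms * eps * σ)`, `fl (Ms ^ 2 * eps * σ)` — ONE rounding of the exact
  value, as in `AccSum` (`two_pow_sq`: `Ms² = 2²ᴹ'`; these are powers of two `≥ eta`, computed exactly, while
  the loop runs, `σ > ½eps⁻¹eta`).
* `σ₀ = 2ᴹ·NextPowerTwo(μ)` ↦ `sigmaStart fl p xs = fl (twoPowM · nextPowerTwo fl p μ)` — exact, `= 2^(M'+K)`
  with `NextPowerTwo(μ) = 2^K ≥ μ`, `K ∈ {⌈log₂ μ⌉, ⌈log₂ μ⌉ + 1}` (`nextPowerTwo_maxAbs_eq`, `sigmaStart_eq`).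
* the `repeat–until` loop with the zero exit ↦ `transformFinalLoop fl Ms eps (½eps⁻¹eta) fuel t σ p :
  (ℚ × ℚ × List ℚ × ℚ) ⊕ List ℚ` — `Sum.inl [τ₁, τ₂, p, σ]` when the loop stops by the `until` condition,
  `Sum.inr p` when it is left with `t′ = 0` for the restart; structural recursion on a pass budget
  (`loopFuel emin σ₀ = log₂ σ₀ − emin + 1`, never exhausted: `transformFinalLoop_spec`); its postcondition ↦
  `LoopPost`.
* `Transform(p)` of Algorithm 4.4 with its recursive call ↦ `transformFinal fl p emin xs`, through
  `transformFinalAux fl p emin depth xs` — structural recursion on a RESTART budget `depth = ⌈log₂ μ⌉ − emin + 1`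
  (never exhausted: `transformFinalAux_spec`); its postcondition ↦ `FinalPost` (Lemma 4.2's assertions, or the
  outcome `τ₁ = τ₂ = σ = 0`, `p′ = 0`, `s = 0` of a restart on the zero vector, NOTE (c)).
* `AccSum` (Algorithm 4.5, as executed by Algorithm 6.1) ↦ `accSumFinal fl p emin xs = fl(τ₁ + fl(τ₂ + flSum p′))`
  over `transformFinal`.
* the printed hypothesis "`M = ⌈log₂(n + 2)⌉`, `2²ᴹeps ≤ 1`" ↦ `2 * Nat.clog 2 (xs.length + 2) ≤ p`; its analogue
  for the computed `2ᴹ` ↦ `twoPowM fl p xs ^ 2 * unitRoundoff p ≤ 1`; "`length(p) + 2` is a floating-point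
  number" (implicit in `NextPowerTwo(length(p) + 2)`) ↦ `IsFloat p emin (n + 2)` (automatic for `n + 2 < eps⁻¹`
  when `emin ≤ 0`: `isFloat_length_add_two`); "IEEE 754, rounding tie to even" ↦ `fl = roundTiesEven p emin`.

Typed and PROVED here (all sorry-free; `[cite: …]` locators on every declaration):
* ALGORITHMS 4.4 / 4.5 — `transformFinalLoop`, `twoPowM`, `sigmaStart`, `loopFuel`, `transformFinalAux`,
  `transformFinal`, `accSumFinal` (definitions); `transformFinal_of_maxAbs_eq_zero`,
  `accSumFinal_of_maxAbs_eq_zero` ("if μ = 0"); eq. (2.3) as used by the check for zero,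
  `add_eq_zero_of_fl_add_eq_zero`.
* the first lines of Algorithm 4.4 — `twoPowM_eq`, `twoPowM_roundTiesEven`, `nextPowerTwo_maxAbs_eq`,
  `sigmaStart_eq`, `loopFuel_two_zpow`, `emin_le_clog_maxAbs`, `isFloat_length_add_two`,
  `two_mul_le_prec_of_sq_mul_u_le_one` (`(2^M')²eps ≤ 1 ⟺ 2M' ≤ p`).
* LEMMA 4.2 — `transformFinalLoop_spec` (the loop: the invariant (4.2)–(4.3), exactness of `t′ = fl(t + τ)`
  while it continues, Lemma 2.6 and (4.4)–(4.5) at the `until` exit — as `transformAux_spec` — plus the zero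
  exit: `t + τ = 0` by (2.3), hence `s = Σ p′ᵢ` by (4.2), with `p′ ⊆ F`, `max |p′ᵢ| ≤ epsσ` by Theorem 3.5);
  `transformFinalAux_spec` and **`transformFinal_spec`** (Lemma 4.2 for Algorithm 4.4 with its restarts: the
  results satisfy (4.2)–(4.5) with `M = ⌈log₂(n + 2)⌉` — `FinalPost`); `TransformSpec.of_le` ((4.5) is
  antitone in `M`, so the possibly larger computed `M'` is harmless).
* LEMMA 4.3 — `faithful_of_finalPost_tree` (`Σ p′ᵢ` in ANY order), `accSumFinal_spec_of_maxAbs_ne_zero`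
  (`res ∈ □(s)`; `res = 0 ⟹ τ₁ = τ₂ = 0, p′ = 0, s = 0` (4.23); (4.11) for `res ≠ 0`),
  `abs_sum_sub_accSumFinal_lt` ((4.11)).
* PROPOSITION 4.6 — **`isFaithfulRounding_accSumFinal`** (every rounding to nearest: `p ⊆ F`, `n + 2 ∈ F`,
  `(2ᴹ)²eps ≤ 1` for the computed `2ᴹ` ⟹ `AccSum(p) ∈ □(Σ pᵢ)`; zero and empty vector included),
  **`isFaithfulRounding_accSumFinal_roundTiesEven`** (IEEE 754 ties to even, `emin ≤ 0`: the PRINTED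
  hypothesis `2²ᴹeps ≤ 1`, `M = ⌈log₂(n + 2)⌉`, suffices — `hyps_of_roundTiesEven`, via Theorem 3.7),
  `isFaithfulRounding_accSumFinal_of_isRoundNearest` (any tie rule, `emin ≤ 0`: `2^(2(M+1))eps ≤ 1` suffices),
  `isFaithful_accSumFinal` (the same in the tree's `IsFaithful`).
* COROLLARY 4.7 — (4.24) `accSumFinal_eq_sum_of_isFloat_sum` (`s ∈ F ⟹ res = s`) and
  `accSumFinal_eq_sum_of_abs_le` (`res ∈ U ⟹ res = s`, from `IsFaithfulRounding.eq_sum_of_abs_le`, valid for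
  any faithful rounding of a sum of floats); `accSumFinal_eq_zero_iff` (`res = 0 ⟺ s = 0`);
  `accSumFinal_pos_iff_and_neg_iff` (`sign(res) = sign(s)`, from `IsFaithfulRounding.pos_iff_and_neg_iff`).

NOTES. (a) HYPOTHESES AND TIE RULE. Algorithm 4.4 differs from Algorithm 4.1 (typed in `AccSum`) in computing
`2ᴹ` and `σ₀` by `NextPowerTwo` — whose Theorem 3.7 needs ties to even ("mandatory"; `NextPowerTwo`): under
another rounding to nearest `NextPowerTwo(n + 2)` may be `2^(⌈log₂(n+2)⌉+1)` (when `n + 2` is a power of two)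
and `NextPowerTwo(μ) = 2μ` (for `μ` a power of two). Neither affects the analysis — Lemma 4.2 needs only
`σ₀ = 2^M'·2^K` with `2^K ≥ μ`, and a larger `M'` strengthens (4.5) — PROVIDED `2²ᴹ'eps ≤ 1` holds for the
computed `M'`. Hence the core theorems carry `twoPowM fl p xs ^ 2 * unitRoundoff p ≤ 1` (and `n + 2 ∈ F`),
which under ties to even with `emin ≤ 0` IS the printed `2²ᴹeps ≤ 1` (`hyps_of_roundTiesEven`), and under an
arbitrary tie rule follows from one more bit, `2^(2(M+1))eps ≤ 1`. Everything else holds for every rounding to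
nearest, as in `AccSum` (NOTE (a) there).
(b) FUEL. Two structural-recursion budgets, neither of which ever binds (so `transformFinal` IS Algorithm 4.4
on every vector of floats meeting the hypotheses of Lemma 4.2): the pass budget `loopFuel` of the loop (as in
`AccSum`, NOTE (b): `σ` is divided by `2⁻ᴹeps⁻¹ ≥ 4` per pass and the loop is left once `σ ≤ ½eps⁻¹eta`), and
the restart budget `⌈log₂ μ⌉ − emin + 1` of `transformFinal` (a restart acts on the vector `p′` of remaining
parts, `max |p′ᵢ| ≤ epsσ ≤ 2^(M'+K−p)`, so `⌈log₂ μ′⌉ ≤ ⌈log₂ μ⌉ + 1 + M' − 2M' ≤ ⌈log₂ μ⌉ − 1`, while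
`⌈log₂ μ′⌉ ≥ emin` as long as `p′ ≠ 0`). With either budget `0` — unreachable — the typed functions return the
current state / `τ₁ = τ₂ = σ = 0`, which is also the genuine answer on the zero vector.
(c) THE RESTART ON THE ZERO VECTOR. If `t′ = 0` and every remaining part is zero (`s = 0`), the recursive call
answers "if μ = 0, τ₁ = τ₂ = σ = 0" — a state with `σ = 0`, outside `TransformSpec` as typed (`σ = 2^k`,
`k ≥ emin`, used by Lemma 4.3's proof), although (4.2)–(4.5) hold for it trivially. `FinalPost` therefore reads
"`TransformSpec` OR (`τ₁ = τ₂ = σ = 0`, `p′ = 0`, `s = 0`)", and the CONCLUSIONS of Lemma 4.3 (faithfulness,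
(4.23), (4.11)) are proved from either alternative (`faithful_of_finalPost_tree`: `res = fl(0 + fl(0 + 0)) = 0 = s`).
(d) NOT typed here: the deviations of the Matlab code Algorithm 6.1 from Algorithms 4.4 / 4.5 as printed (it
tests the `until` condition BEFORE `t = 0` — the two orders differ only when `t′ = 0 ∧ σ ≤ ½eps⁻¹eta` — recurses
through `AccSum` rather than `Transform`, guards `n = 0`, and mentions eliminating zero summands); the remarks
"it might be advantageous to eliminate zero components" and "one call to ExtractVector may be saved"; flop
counts, Table 4.1, §5, overflow ("easily done by scaling"), and Part II.
-/

namespace Literature.ComputerArithmetic.RumpOgitaOishi2008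

open Literature.ComputerArithmetic.JeannerodRump2018
open Literature.ComputerArithmetic.JeannerodRump2018.SumTree
open Literature.ComputerArithmetic.BoldoJeannerodMelquiondMuller2023
-- landed engine lemmas reused by name (`2^k ∈ F`, `|f| ≥ eta` for `f ∈ F \ {0}`):
open Literature.ComputerArithmetic.JoldesMullerPopescu2017 (isFloat_two_zpow two_zpow_emin_le_abs)

variable {p : ℕ} {emin : ℤ} {fl : ℚ → ℚ}

/-! ### Algorithm 4.4 (`Transform`, final version) and Algorithm 4.5 (`AccSum`) over it — the definitions -/

/-- **ALGORITHM 4.4, the `repeat–until` loop with the check for zero**, loop state `(t, σ, p)` (the source's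
`t′`, `σ′` on entry of a pass), explicit fuel: one pass computes `[τ, p] = ExtractVector(σ, p)`,
`t′ = fl(t + τ)`; `if t′ = 0` the loop is LEFT FOR A RESTART `Transform(p)` on the vector of remaining parts
(result `Sum.inr p`); otherwise `σ′ = fl(2ᴹepsσ)` and the loop stops — returning
`Sum.inl ([τ₁, τ₂] = FastTwoSum(t, τ), p, σ)` — when `|t′| ≥ fl(2²ᴹepsσ)` or `σ ≤ ½eps⁻¹eta` (`eta₂`), else
continues with `(t′, σ′, p)`. `Ms` is the floating-point number `2ᴹ = NextPowerTwo(n + 2)` of the first lines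
of Algorithm 4.4 (so `2ᴹeps = Ms·eps`, `2²ᴹeps = Ms²·eps`, the constants `phi`, `factor` of the source's
executable Algorithm 6.1); `u = eps`. With fuel `0` the current state is returned (never reached with the
fuel supplied by `transformFinalAux`, see `transformFinalLoop_spec`). [cite: RumpOgitaOishi2008, Algorithm 4.4] -/
def transformFinalLoop (fl : ℚ → ℚ) (Ms u eta₂ : ℚ) :
    ℕ → ℚ → ℚ → List ℚ → (ℚ × ℚ × List ℚ × ℚ) ⊕ List ℚ
  | 0, t, σ, xs => Sum.inl (t, 0, xs, σ)
  | fuel + 1, t, σ, xs =>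
      if fl (t + (extractVector fl σ xs).1) = 0 then Sum.inr (extractVector fl σ xs).2
      else if fl (Ms ^ 2 * u * σ) ≤ |fl (t + (extractVector fl σ xs).1)| ∨ σ ≤ eta₂ then
        Sum.inl ((fast2Sum fl t (extractVector fl σ xs).1).1, (fast2Sum fl t (extractVector fl σ xs).1).2,
          (extractVector fl σ xs).2, σ)
      else
        transformFinalLoop fl Ms u eta₂ fuel (fl (t + (extractVector fl σ xs).1)) (fl (Ms * u * σ))
          (extractVector fl σ xs).2

/-- `2ᴹ` as Algorithm 4.4 computes it: `M = NextPowerTwo(length(p) + 2)` — in the words of the source's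
appendix, "the variable `Ms` refers to `2ᴹ`" (Algorithm 6.1: `Ms = NextPowerTwo(n+2); % n+2 <= 2^M = Ms`).
[cite: RumpOgitaOishi2008, Algorithm 4.4 / Algorithm 6.1] -/
def twoPowM (fl : ℚ → ℚ) (p : ℕ) (xs : List ℚ) : ℚ :=
  nextPowerTwo fl p (xs.length + 2)

/-- `σ₀ = 2ᴹ·NextPowerTwo(μ)` as Algorithm 4.4 computes it (`σ′ = 2ᴹ NextPowerTwo(µ)`; Algorithm 6.1:
`sigma = Ms*NextPowerTwo(mu); % first extraction unit` — a floating-point product of two powers of two,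
exact in this model, `sigmaStart_eq`). [cite: RumpOgitaOishi2008, Algorithm 4.4 / Algorithm 6.1] -/
def sigmaStart (fl : ℚ → ℚ) (p : ℕ) (xs : List ℚ) : ℚ :=
  fl (twoPowM fl p xs * nextPowerTwo fl p (maxAbs xs))

/-- The pass budget handed to the loop started with extraction unit `σ₀`: `log₂ σ₀ − emin + 1` (the unit
is divided by `2⁻ᴹeps⁻¹ ≥ 2` per pass and the loop exits once `σ ≤ ½eps⁻¹eta`; `transformFinalLoop_spec`).
[cite: RumpOgitaOishi2008, Algorithm 4.4 / Lemma 4.2] -/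
def loopFuel (emin : ℤ) (σ₀ : ℚ) : ℕ :=
  (Int.log 2 σ₀ - emin).toNat + 1

/-- **ALGORITHM 4.4 (`Transform`, final version) with an explicit restart budget `depth`**: `μ = max |pᵢ|`;
`if μ = 0, τ₁ = τ₂ = σ = 0, return` (`p` unchanged, the zero vector); `M = NextPowerTwo(length(p) + 2)`
(i.e. `2ᴹ = twoPowM`), `σ′ = 2ᴹ·NextPowerTwo(μ)` (`sigmaStart`), `t′ = 0`, the loop `transformFinalLoop`; on
`t′ = 0` the restart `[τ₁, τ₂, p, σ] = Transform(p)` on the extracted vector, with budget `depth − 1`. With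
budget `0` it returns `τ₁ = τ₂ = σ = 0` and `p` unchanged — which IS the answer on the zero vector, and is never
met on a nonzero one with the budget supplied by `transformFinal` (`transformFinalAux_spec`).
[cite: RumpOgitaOishi2008, Algorithm 4.4] -/
def transformFinalAux (fl : ℚ → ℚ) (p : ℕ) (emin : ℤ) : ℕ → List ℚ → ℚ × ℚ × List ℚ × ℚ
  | 0, xs => (0, 0, xs, 0)
  | depth + 1, xs =>
      if maxAbs xs = 0 then (0, 0, xs, 0)
      else
        match transformFinalLoop fl (twoPowM fl p xs) (unitRoundoff p) ((2 : ℚ) ^ (emin + p - 1))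
            (loopFuel emin (sigmaStart fl p xs)) 0 (sigmaStart fl p xs) xs with
        | Sum.inl r => r
        | Sum.inr xs' => transformFinalAux fl p emin depth xs'

/-- **ALGORITHM 4.4 (`Transform`, final version of Algorithm 4.1 with check for zero)**: error-free
transformation of a vector `p` of floating-point numbers into `[τ₁, τ₂, p′, σ]`, with `M` and `σ₀` computed by
Algorithm 3.6 (`NextPowerTwo`) "so that only basic floating-point operations are necessary", and the recursive
restart `Transform(p)` whenever `t′ = fl(t + τ) = 0` (then `s = Σ pᵢ` for the extracted vector, by (2.3) and
(4.2)). The restart budget `⌈log₂ μ⌉ − emin + 1` exceeds the number of restarts (each lowers `⌈log₂ max |pᵢ|⌉`,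
which stays `≥ emin` while the vector is nonzero; `transformFinalAux_spec`), so this IS Algorithm 4.4 on every
input satisfying the hypotheses of Lemma 4.2. The format parameters `p` (`eps = 2^-p`) and `emin`
(`½eps⁻¹eta = 2^(emin+p-1)`) are arguments, as `eps`/`realmin` are in Algorithm 6.1.
[cite: RumpOgitaOishi2008, Algorithm 4.4] -/
def transformFinal (fl : ℚ → ℚ) (p : ℕ) (emin : ℤ) (xs : List ℚ) : ℚ × ℚ × List ℚ × ℚ :=
  transformFinalAux fl p emin ((Int.clog 2 (maxAbs xs) - emin).toNat + 1) xs

/-- **ALGORITHM 4.5 (`AccSum`) over the final `Transform` (Algorithm 4.4)** — the algorithm of the source's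
executable Algorithm 6.1 "including check for zero sum": `[τ₁, τ₂, p′] = Transform(p)`,
`res = fl(τ₁ + (τ₂ + Σ p′ᵢ))` (the inner sum by ordinary recursive summation `flSum`; any order is covered by
`faithful_of_finalPost_tree`). [cite: RumpOgitaOishi2008, Algorithm 4.5 / Algorithm 6.1] -/
def accSumFinal (fl : ℚ → ℚ) (p : ℕ) (emin : ℤ) (xs : List ℚ) : ℚ :=
  fl ((transformFinal fl p emin xs).1 +
    fl ((transformFinal fl p emin xs).2.1 + flSum fl (transformFinal fl p emin xs).2.2.1))

/-! ### Small facts: (2.3), the zero vector, `TransformSpec` is antitone in `M` -/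

/-- Eq. (2.3): `fl(a + b) = 0 ⟹ a + b = 0` for `a, b ∈ F` — the fact behind the check for zero ("in that
case `t⁽ᵐ⁾ = fl(t⁽ᵐ⁻¹⁾ + τ⁽ᵐ⁾) = 0 = t⁽ᵐ⁻¹⁾ + τ⁽ᵐ⁾` because of (2.3)").
[cite: RumpOgitaOishi2008, §2 eq. (2.3) / §4 (p. 21, before Algorithm 4.4)] -/
theorem add_eq_zero_of_fl_add_eq_zero (hp : 1 ≤ p) (hfl : IsRoundNearest p emin fl) {a b : ℚ}
    (ha : IsFloat p emin a) (hb : IsFloat p emin b) (h : fl (a + b) = 0) : a + b = 0 := by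
  by_contra h0
  have := eta_le_abs_fl_add hp hfl ha hb h0
  rw [h, abs_zero] at this
  exact absurd this (not_le.mpr (two_zpow_pos emin))

/-- A nonzero float forces precision `p ≥ 1` (in precision `0` the only float is `0`).
[cite: RumpOgitaOishi2008, §2 (p. 4, `F`)] -/
theorem one_le_prec_of_isFloat_ne_zero {x : ℚ} (hx : IsFloat p emin x) (hx0 : x ≠ 0) : 1 ≤ p := by
  by_contra hp
  have hp0 : p = 0 := by omega
  obtain ⟨M, e, hM, -, rfl⟩ := hx
  rw [hp0, pow_zero] at hM
  have hM0 : M = 0 := Int.abs_lt_one_iff.mp hM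
  exact hx0 (by rw [hM0]; simp)

/-- On the zero vector (and on the empty one) the final `Transform` returns `τ₁ = τ₂ = σ = 0`, `p` unchanged,
whatever the budget. [cite: RumpOgitaOishi2008, Algorithm 4.4 ("if μ = 0")] -/
theorem transformFinalAux_of_maxAbs_eq_zero (fl : ℚ → ℚ) (p : ℕ) (emin : ℤ) {xs : List ℚ}
    (h : maxAbs xs = 0) : ∀ depth : ℕ, transformFinalAux fl p emin depth xs = (0, 0, xs, 0)
  | 0 => rfl
  | _ + 1 => by rw [transformFinalAux, if_pos h]

/-- On the zero vector (and on the empty one) `Transform` (final version) returns `τ₁ = τ₂ = σ = 0` and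
`p′ = p (= 0)`. [cite: RumpOgitaOishi2008, Algorithm 4.4 ("if μ = 0")] -/
theorem transformFinal_of_maxAbs_eq_zero (fl : ℚ → ℚ) (p : ℕ) (emin : ℤ) {xs : List ℚ}
    (h : maxAbs xs = 0) : transformFinal fl p emin xs = (0, 0, xs, 0) :=
  transformFinalAux_of_maxAbs_eq_zero fl p emin h _

/-- The assertions of Lemma 4.2 only get weaker as `M` decreases (`M` enters through (4.5)
`|τ₁| ≥ 2²ᴹepsσ` alone): `TransformSpec` with `M′ ≥ M` implies `TransformSpec` with `M`. (Used to state the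
results of Algorithm 4.4 — whose `2ᴹ = NextPowerTwo(n + 2)` may exceed `2^⌈log₂(n+2)⌉` under a rounding to
nearest other than ties-to-even — uniformly with `M = ⌈log₂(n + 2)⌉`.) [cite: RumpOgitaOishi2008, Lemma 4.2 eq. (4.5)] -/
theorem TransformSpec.of_le {M M' : ℕ} (hMM' : M ≤ M') {s : ℚ} {n : ℕ} {τ₁ τ₂ σ : ℚ} {xs' : List ℚ}
    (H : TransformSpec p emin fl M' s n τ₁ τ₂ xs' σ) : TransformSpec p emin fl M s n τ₁ τ₂ xs' σ where
  two_zpow := H.two_zpow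
  length_eq := H.length_eq
  low := H.low
  isFloat₁ := H.isFloat₁
  isFloat₂ := H.isFloat₂
  last := H.last
  exit hσ := by
    obtain ⟨k, -, hk⟩ := H.two_zpow
    have h := H.exit hσ
    refine le_trans ?_ h
    have hσ0 : 0 ≤ unitRoundoff p * σ := mul_nonneg u_pos.le (by rw [hk]; exact (two_zpow_pos k).le)
    rw [mul_assoc, mul_assoc]
    exact mul_le_mul_of_nonneg_right (pow_le_pow_right₀ (by norm_num) (by omega)) hσ0

/-! ### Lemma 4.2 for the loop of Algorithm 4.4 -/

/-- The postcondition of the loop of Algorithm 4.4 entered for a sum `s` of `n` terms: EITHER it stopped by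
the `until` condition in a state `[τ₁, τ₂, p, σ]` satisfying the assertions (4.2)–(4.5) of Lemma 4.2
(`TransformSpec`), OR it was left with `t′ = 0` for a restart on a vector `p` of `n` floating-point numbers with
`Σ pᵢ = s` (by (2.3) and (4.2)) and `max |pᵢ| ≤ B` (`B = epsσ` for the extraction unit `σ` on entry).
[cite: RumpOgitaOishi2008, Algorithm 4.4 / Lemma 4.2] -/
def LoopPost (p : ℕ) (emin : ℤ) (fl : ℚ → ℚ) (M : ℕ) (s : ℚ) (n : ℕ) (B : ℚ) :
    (ℚ × ℚ × List ℚ × ℚ) ⊕ List ℚ → Prop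
  | Sum.inl r => TransformSpec p emin fl M s n r.1 r.2.1 r.2.2.1 r.2.2.2
  | Sum.inr xs' => xs'.length = n ∧ (∀ x ∈ xs', IsFloat p emin x ∧ |x| ≤ B) ∧ s = xs'.sum

/-- `LoopPost` is monotone in the bound `B` on the restart vector. [cite: RumpOgitaOishi2008, Algorithm 4.4] -/
theorem LoopPost.mono {M : ℕ} {s : ℚ} {n : ℕ} {B B' : ℚ} (hBB' : B ≤ B') :
    ∀ {r : (ℚ × ℚ × List ℚ × ℚ) ⊕ List ℚ}, LoopPost p emin fl M s n B r → LoopPost p emin fl M s n B' r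
  | Sum.inl _, h => h
  | Sum.inr _, ⟨h1, h2, h3⟩ => ⟨h1, fun x hx => ⟨(h2 x hx).1, (h2 x hx).2.trans hBB'⟩, h3⟩

/-- `(2ᴹ)² = 2²ᴹ`: the constant `Ms²·eps` of Algorithm 4.4 / 6.1 is the `2²ᴹeps` of Algorithm 4.1.
[cite: RumpOgitaOishi2008, Algorithm 4.4 / Algorithm 6.1 (`factor = 2^(-53)*Ms*Ms`)] -/
theorem two_pow_sq (M : ℕ) : ((2 : ℚ) ^ M) ^ 2 = 2 ^ (2 * M) := by
  rw [← pow_mul, mul_comm]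

/-- **LEMMA 4.2 for the loop of ALGORITHM 4.4.** Entering a pass with `σ = 2^k`, `k ≥ emin`, `p` of length
`n` with `n + 2 ≤ 2ᴹ` (`2ᴹ = Ms`), entries in `F` bounded by `2^-M σ`, `t ∈ F ∩ epsσℤ`, `s = t + Σ pᵢ`, and
`2²ᴹeps ≤ 1` (`2M ≤ p`), the loop terminates within `k − emin + 1` passes, EITHER by the `until` condition in a
state satisfying `TransformSpec` (exactly as for Algorithm 4.1, `transformAux_spec`: while it continues,
`σ > ½eps⁻¹eta` makes `fl(2ᴹepsσ)`, `fl(2²ᴹepsσ)` exact powers of two and `t′ = t + τ` exact by (2.21), Theorem 3.5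
supplies (4.2)–(4.3), and at the exit Lemma 2.6 gives (4.4)), OR with `t′ = fl(t + τ) = 0`, in which case
`t + τ = 0` by (2.3) and (4.2) reads `s = Σ pᵢ` for the extracted vector, whose entries are floats bounded by
`epsσ` (Theorem 3.5). [cite: RumpOgitaOishi2008, Lemma 4.2 / Algorithm 4.4 (p. 21)] -/
theorem transformFinalLoop_spec (hp : 1 ≤ p) (hfl : IsRoundNearest p emin fl) {M : ℕ} (h2M : 2 * M ≤ p)
    {n : ℕ} (hnM : n + 2 ≤ 2 ^ M) (s : ℚ) :
    ∀ (fuel : ℕ) (t : ℚ) (k : ℤ) (xs : List ℚ), emin ≤ k → k - emin < fuel → xs.length = n →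
      (∀ x ∈ xs, IsFloat p emin x ∧ |x| ≤ (2 : ℚ) ^ (k - M)) → IsFloat p emin t →
      OnGrid (unitRoundoff p * (2 : ℚ) ^ k) t → s = t + xs.sum →
      LoopPost p emin fl M s n (unitRoundoff p * (2 : ℚ) ^ k)
        (transformFinalLoop fl ((2 : ℚ) ^ M) (unitRoundoff p) ((2 : ℚ) ^ (emin + p - 1)) fuel t
          ((2 : ℚ) ^ k) xs)
  | 0, t, k, xs, hk, hfuel, _, _, _, _, _ => absurd hfuel (by push_cast; omega)
  | fuel + 1, t, k, xs, hk, hfuel, hlen, hxs, ht, htg, hs => by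
      have hM : M < p := by omega
      have hnlt : xs.length < 2 ^ M := by rw [hlen]; omega
      have hdiv : (2 : ℚ) ^ k / 2 ^ M = (2 : ℚ) ^ (k - M) := by
        rw [zpow_sub₀ (by norm_num : (2 : ℚ) ≠ 0), zpow_natCast]
      have hxs' : ∀ x ∈ xs, IsFloat p emin x ∧ |x| ≤ (2 : ℚ) ^ k / 2 ^ M := by
        intro x hx; rw [hdiv]; exact hxs x hx
      obtain ⟨hsum, hlo, hτabs, hnσ, hτg, -, hτF⟩ := extractVector_eft hp hfl hk hM hxs' hnlt
      have hτlt : |(extractVector fl ((2 : ℚ) ^ k) xs).1| < (2 : ℚ) ^ k := hτabs.trans_lt hnσ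
      simp only [transformFinalLoop]
      set τ : ℚ := (extractVector fl ((2 : ℚ) ^ k) xs).1 with hτdef
      set xs₁ : List ℚ := (extractVector fl ((2 : ℚ) ^ k) xs).2 with hxs₁def
      have hlen₁ : xs₁.length = n := by rw [hxs₁def, length_extractVector_snd, hlen]
      have hxs₁F : ∀ x ∈ xs₁, IsFloat p emin x := isFloat_of_mem_extractVector_snd hfl _ xs
      have hupos := u_pos (p := p)
      have h2k := two_zpow_pos k
      by_cases hzero : fl (t + τ) = 0
      · -- the check for zero: `t′ = 0`, hence `t + τ = 0` (2.3) and `s = Σ p′ᵢ` (4.2); restart on `p′`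
        rw [if_pos hzero]
        have htτ : t + τ = 0 := add_eq_zero_of_fl_add_eq_zero hp hfl ht hτF hzero
        exact ⟨hlen₁, fun x hx => ⟨hxs₁F x hx, hlo x hx⟩, by rw [hs, hsum, ← add_assoc, htτ, zero_add]⟩
      rw [if_neg hzero]
      split_ifs with hstop
      · -- the loop stops: `[τ₁, τ₂] = FastTwoSum(t, τ)`
        have hft : (fast2Sum fl t τ).1 = fl (t + τ) := rfl
        -- Lemma 2.6 / FastTwoSum: `τ₁ + τ₂ = t + τ`, `|τ₂| ≤ eps·ufp(τ₁)`
        have hF2S : (fast2Sum fl t τ).1 + (fast2Sum fl t τ).2 = t + τ ∧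
            |(fast2Sum fl t τ).2| ≤ unitRoundoff p * ufp (fast2Sum fl t τ).1 := by
          by_cases hτ0 : τ = 0
          · obtain ⟨-, h2, h3⟩ := fast2Sum_correct hp hfl ht hτF (by rw [hτ0, abs_zero]; exact abs_nonneg t)
            refine ⟨h3, ?_⟩
            rw [h2, hτ0, add_zero, fl_eq_self hfl ht, sub_self, abs_zero]
            exact mul_nonneg hupos.le (ufp_nonneg _)
          · -- `t ∈ epsσℤ = 2^(k-p)ℤ ⊆ 2eps·ufp(τ)ℤ` because `ufp(τ) ≤ 2^(k-1)`
            obtain ⟨e, he⟩ := exists_ufp_eq_two_zpow hτ0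
            have hek : e ≤ k - 1 := by
              have h1 : ufp τ ≤ (2 : ℚ) ^ (k - 1) :=
                ufp_le_two_zpow_of_abs_lt (by rwa [show k - 1 + 1 = k by ring])
              rw [he] at h1
              exact (zpow_le_zpow_iff_right₀ (by norm_num : (1 : ℚ) < 2)).mp h1
            have htg' : OnGrid (2 * unitRoundoff p * ufp τ) t := by
              rw [he, two_mul_u_mul_two_zpow]
              rw [u_mul_two_zpow] at htg
              exact htg.of_le (by omega)
            obtain ⟨-, -, h3, h4, h5⟩ := fastTwoSum_eft hp hfl ht hτF htg'
            exact ⟨h3, h4.trans h5⟩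
        refine
          { two_zpow := ⟨k, hk, rfl⟩
            length_eq := hlen₁
            low := fun x hx => ⟨hxs₁F x hx, hlo x hx⟩
            isFloat₁ := (hfl _).1
            isFloat₂ := (hfl _).1
            last := ⟨t, τ, ht, hτF, htg, hτg, hτlt, by rw [hs, hsum]; ring, hF2S.1, hft, hF2S.2⟩
            exit := fun hσ => ?_ }
        -- (4.5): the second exit condition fails, so the first one holds, and `fl(2²ᴹepsσ) = 2²ᴹepsσ`
        have hkp : emin + p ≤ k := by
          by_contra hlt
          have : (2 : ℚ) ^ k ≤ (2 : ℚ) ^ (emin + p - 1) := zpow_le_zpow_right₀ (by norm_num) (by omega)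
          exact absurd hσ (not_lt.mpr this)
        have hexact : fl (((2 : ℚ) ^ M) ^ 2 * unitRoundoff p * (2 : ℚ) ^ k) =
            2 ^ (2 * M) * unitRoundoff p * (2 : ℚ) ^ k := by
          rw [two_pow_sq, two_pow_mul_u_mul_two_zpow]
          exact fl_eq_self hfl (isFloat_two_zpow hp (by push_cast; omega))
        rcases hstop with h | h
        · simpa [hexact, hft] using h
        · exact absurd hσ (not_lt.mpr h)
      · -- the loop continues with `t′ = t + τ` (exact), `σ′ = 2ᴹepsσ = 2^(k+M-p)`, `p′ = xs₁`
        obtain ⟨hlt, hσgt⟩ := not_or.mp hstop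
        have hlt : |fl (t + τ)| < fl (((2 : ℚ) ^ M) ^ 2 * unitRoundoff p * (2 : ℚ) ^ k) := not_le.mp hlt
        have hσgt : (2 : ℚ) ^ (emin + p - 1) < (2 : ℚ) ^ k := not_le.mp hσgt
        have hkp : emin + p ≤ k := by
          by_contra hlt'
          have : (2 : ℚ) ^ k ≤ (2 : ℚ) ^ (emin + p - 1) := zpow_le_zpow_right₀ (by norm_num) (by omega)
          exact absurd hσgt (not_lt.mpr this)
        have hρ : fl (((2 : ℚ) ^ M) ^ 2 * unitRoundoff p * (2 : ℚ) ^ k) = (2 : ℚ) ^ (k + (2 * M : ℕ) - p) := by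
          rw [two_pow_sq, two_pow_mul_u_mul_two_zpow]
          exact fl_eq_self hfl (isFloat_two_zpow hp (by push_cast; omega))
        have hσ' : fl (2 ^ M * unitRoundoff p * (2 : ℚ) ^ k) = (2 : ℚ) ^ (k + M - p) := by
          rw [two_pow_mul_u_mul_two_zpow]
          exact fl_eq_self hfl (isFloat_two_zpow hp (by omega))
        -- `t′ = fl(t + τ) = t + τ`: `|fl(t + τ)| < 2²ᴹepsσ ≤ σ` and `t, τ ∈ F ∩ epsσℤ` (eq. (2.21))
        have ht'lt : |fl (t + τ)| < (2 : ℚ) ^ k := by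
          rw [hρ] at hlt
          exact hlt.trans_le (zpow_le_zpow_right₀ (by norm_num) (by push_cast; omega))
        have ht'eq : fl (t + τ) = t + τ := fl_add_eq_add_of_abs_fl_lt hp hfl ht hτF htg hτg ht'lt
        -- the invariant for the next pass, with `k' = k + M - p`
        have hk' : emin ≤ k + M - p := by omega
        have hfuel' : k + M - p - emin < fuel := by push_cast at hfuel ⊢; omega
        have hxs₁' : ∀ x ∈ xs₁, IsFloat p emin x ∧ |x| ≤ (2 : ℚ) ^ (k + M - p - M) := by
          intro x hx
          refine ⟨hxs₁F x hx, ?_⟩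
          have := hlo x hx
          rwa [u_mul_two_zpow, show k - (p : ℤ) = k + M - p - M by ring] at this
        have ht'g : OnGrid (unitRoundoff p * (2 : ℚ) ^ (k + M - p)) (fl (t + τ)) := by
          rw [ht'eq, u_mul_two_zpow]
          have := htg.add hτg
          rw [u_mul_two_zpow] at this
          exact this.of_le (by omega)
        have hs' : s = fl (t + τ) + xs₁.sum := by rw [ht'eq, hs, hsum]; ring
        have IH := transformFinalLoop_spec hp hfl h2M hnM s fuel (fl (t + τ)) (k + M - p) xs₁ hk' hfuel'
          hlen₁ hxs₁' (hfl _).1 ht'g hs'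
        rw [hσ']
        refine IH.mono ?_
        rw [u_mul_two_zpow, u_mul_two_zpow]
        exact zpow_le_zpow_right₀ (by norm_num) (by omega)


/-! ### The first lines of Algorithm 4.4: `2ᴹ = NextPowerTwo(n + 2)` and `σ₀ = 2ᴹ·NextPowerTwo(μ)` -/

/-- An integer `m < eps⁻¹ = 2^p` is a floating-point number when `emin ≤ 0` (`m = m·2⁰`; in IEEE 754 binary64
`½eps⁻¹eta = 2^(emin+p-1) = 2^-1022`, `emin = −1074 ≤ 0`). [cite: RumpOgitaOishi2008, §2 (p. 4, `F`, `eta`)] -/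
theorem isFloat_natCast_of_lt (hemin : emin ≤ 0) {m : ℕ} (hm : m < 2 ^ p) : IsFloat p emin (m : ℚ) := by
  have h := isFloat_of_int_mul (p := p) (emin := emin) (m : ℤ) 0
    (by rw [abs_of_nonneg (by positivity)]; exact_mod_cast hm) hemin
  simpa using h

/-- `length(p) + 2 ∈ F` — the argument of `NextPowerTwo` in the first line of Algorithm 4.4 — as soon as
`n + 2 < eps⁻¹` and `emin ≤ 0`. [cite: RumpOgitaOishi2008, Algorithm 4.4 (`M = NextPowerTwo(length(p) + 2)`)] -/
theorem isFloat_length_add_two (hemin : emin ≤ 0) {xs : List ℚ} (h : xs.length + 2 < 2 ^ p) :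
    IsFloat p emin ((xs.length : ℚ) + 2) := by
  have := isFloat_natCast_of_lt hemin h
  push_cast at this
  exact this

/-- **`2ᴹ = NextPowerTwo(n + 2)` under any rounding to nearest** (Theorem 3.7 and its Remark): it is a power
of two `2^M'` with `n + 2 ≤ 2^M'` and `M' = ⌈log₂(n + 2)⌉` — or `M' = ⌈log₂(n + 2)⌉ + 1`, possible only when
`n + 2` is a power of two and the tie `fl((n+2)(1 + eps))` is rounded away from `n + 2`.
[cite: RumpOgitaOishi2008, Algorithm 4.4 / Theorem 3.7 (Remark)] -/
theorem twoPowM_eq (hp : 1 ≤ p) (hfl : IsRoundNearest p emin fl) {xs : List ℚ}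
    (hn2 : IsFloat p emin ((xs.length : ℚ) + 2)) :
    ∃ M' : ℕ, twoPowM fl p xs = 2 ^ M' ∧ xs.length + 2 ≤ 2 ^ M' ∧ Nat.clog 2 (xs.length + 2) ≤ M' ∧
      M' ≤ Nat.clog 2 (xs.length + 2) + 1 := by
  have hx0 : ((xs.length : ℚ) + 2) ≠ 0 := by positivity
  have hcast : ((xs.length : ℚ) + 2) = ((xs.length + 2 : ℕ) : ℚ) := by push_cast; ring
  have hclog : Int.clog 2 |((xs.length : ℚ) + 2)| = (Nat.clog 2 (xs.length + 2) : ℤ) := by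
    rw [abs_of_pos (by positivity), hcast]
    exact_mod_cast Int.clog_natCast (R := ℚ) 2 (xs.length + 2)
  have hle : xs.length + 2 ≤ 2 ^ Nat.clog 2 (xs.length + 2) := Nat.le_pow_clog (by norm_num) _
  rcases nextPowerTwo_eq_or hp hfl hn2 hx0 with h | ⟨-, h⟩
  · refine ⟨Nat.clog 2 (xs.length + 2), ?_, hle, le_rfl, by omega⟩
    rw [twoPowM, h, hclog, zpow_natCast]
  · refine ⟨Nat.clog 2 (xs.length + 2) + 1, ?_,
      hle.trans (Nat.pow_le_pow_right (by norm_num) (by omega)), by omega, le_rfl⟩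
    rw [twoPowM, h, hclog, show ((Nat.clog 2 (xs.length + 2) : ℤ) + 1)
        = ((Nat.clog 2 (xs.length + 2) + 1 : ℕ) : ℤ) by push_cast; rfl, zpow_natCast]

/-- **`2ᴹ = NextPowerTwo(n + 2) = 2^⌈log₂(n+2)⌉` in IEEE 754 arithmetic** (rounding to nearest, ties to even,
precision `p ≥ 2`; Theorem 3.7): then `M = ⌈log₂(n + 2)⌉` exactly, the `M` of Algorithm 4.1 / Lemma 4.2.
[cite: RumpOgitaOishi2008, Algorithm 4.4 / Theorem 3.7] -/
theorem twoPowM_roundTiesEven (hp : 2 ≤ p) {xs : List ℚ} (hn2 : IsFloat p emin ((xs.length : ℚ) + 2)) :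
    twoPowM (roundTiesEven p emin) p xs = 2 ^ Nat.clog 2 (xs.length + 2) := by
  have hx0 : ((xs.length : ℚ) + 2) ≠ 0 := by positivity
  have hcast : ((xs.length : ℚ) + 2) = ((xs.length + 2 : ℕ) : ℚ) := by push_cast; ring
  rw [twoPowM, nextPowerTwo_roundTiesEven hp hn2 hx0, abs_of_pos (by positivity), hcast]
  have : Int.clog 2 (((xs.length + 2 : ℕ) : ℚ)) = (Nat.clog 2 (xs.length + 2) : ℤ) := by
    exact_mod_cast Int.clog_natCast (R := ℚ) 2 (xs.length + 2)
  rw [this, zpow_natCast]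

/-- For a nonzero vector of floating-point numbers, `μ = max |pᵢ| ≥ eta` (a nonzero float is at least `eta`
in absolute value), hence `⌈log₂ μ⌉ ≥ emin`; and `μ ≤ 2^⌈log₂ μ⌉`.
[cite: RumpOgitaOishi2008, Algorithm 4.4 (`μ = max |pᵢ|`) / §2 (`eta`)] -/
theorem emin_le_clog_maxAbs {xs : List ℚ} (hxs : ∀ x ∈ xs, IsFloat p emin x) (hne : maxAbs xs ≠ 0) :
    emin ≤ Int.clog 2 (maxAbs xs) ∧ maxAbs xs ≤ (2 : ℚ) ^ Int.clog 2 (maxAbs xs) := by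
  obtain ⟨x, hx, hxμ⟩ := exists_abs_eq_maxAbs hne
  have hx0 : x ≠ 0 := by intro h; rw [h, abs_zero] at hxμ; exact hne hxμ.symm
  have hμeta : (2 : ℚ) ^ emin ≤ maxAbs xs := hxμ ▸ two_zpow_emin_le_abs (hxs x hx) hx0
  have hμK : maxAbs xs ≤ (2 : ℚ) ^ Int.clog 2 (maxAbs xs) := by
    have := Int.self_le_zpow_clog (R := ℚ) (b := 2) (by norm_num) (maxAbs xs); exact_mod_cast this
  have h1 := Int.clog_mono_right (b := 2) (two_zpow_pos emin) hμeta
  have h2 : Int.clog 2 ((2 : ℚ) ^ emin) = emin := by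
    have := Int.clog_zpow (R := ℚ) (b := 2) (by norm_num) emin; exact_mod_cast this
  rw [h2] at h1
  exact ⟨h1, hμK⟩

/-- **`NextPowerTwo(μ)` for the nonzero vector** (Theorem 3.7 and its Remark, `μ ∈ F`): a power of two `2^K`
with `μ ≤ 2^K` and `K = ⌈log₂ μ⌉` or `⌈log₂ μ⌉ + 1` (the latter only for `μ` a power of two under a tie rule
other than to-even). [cite: RumpOgitaOishi2008, Algorithm 4.4 (`σ′ = 2ᴹ NextPowerTwo(μ)`) / Theorem 3.7] -/
theorem nextPowerTwo_maxAbs_eq (hp : 1 ≤ p) (hfl : IsRoundNearest p emin fl) {xs : List ℚ}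
    (hxs : ∀ x ∈ xs, IsFloat p emin x) (hne : maxAbs xs ≠ 0) :
    ∃ K : ℤ, nextPowerTwo fl p (maxAbs xs) = 2 ^ K ∧ maxAbs xs ≤ 2 ^ K ∧
      Int.clog 2 (maxAbs xs) ≤ K ∧ K ≤ Int.clog 2 (maxAbs xs) + 1 := by
  obtain ⟨x, hx, hxμ⟩ := exists_abs_eq_maxAbs hne
  have hμF : IsFloat p emin (maxAbs xs) := hxμ ▸ isFloat_abs (hxs x hx)
  have habs : |maxAbs xs| = maxAbs xs := abs_of_nonneg (maxAbs_nonneg xs)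
  have hμK := (emin_le_clog_maxAbs hxs hne).2
  rcases nextPowerTwo_eq_or hp hfl hμF hne with h | ⟨-, h⟩
  · exact ⟨Int.clog 2 (maxAbs xs), by rw [h, habs], hμK, le_rfl, by omega⟩
  · exact ⟨Int.clog 2 (maxAbs xs) + 1, by rw [h, habs],
      hμK.trans (zpow_le_zpow_right₀ (by norm_num) (by omega)), by omega, le_rfl⟩

/-- **`σ₀ = 2ᴹ·NextPowerTwo(μ)` is computed exactly**: a product of two powers of two `2^M' · 2^K` with
`M' + K ≥ K ≥ emin` is in `F` (no overflow in this model), so `σ₀ = fl(2^M'·2^K) = 2^(M'+K)`.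
[cite: RumpOgitaOishi2008, Algorithm 4.4 (`σ′ = 2ᴹ NextPowerTwo(μ)`) / Algorithm 6.1 (`sigma = Ms*NextPowerTwo(mu)`)] -/
theorem sigmaStart_eq (hp : 1 ≤ p) (hfl : IsRoundNearest p emin fl) {xs : List ℚ} {M' : ℕ}
    (hM' : twoPowM fl p xs = 2 ^ M') {K : ℤ} (hK : emin ≤ K)
    (hN : nextPowerTwo fl p (maxAbs xs) = 2 ^ K) : sigmaStart fl p xs = (2 : ℚ) ^ ((M' : ℤ) + K) := by
  rw [sigmaStart, hM', hN, ← zpow_natCast, ← zpow_add₀ (by norm_num : (2 : ℚ) ≠ 0)]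
  exact fl_eq_self hfl (isFloat_two_zpow hp (by omega))

/-- The pass budget for `σ₀ = 2^j` is `j − emin + 1`. [cite: RumpOgitaOishi2008, Algorithm 4.4 / Lemma 4.2] -/
theorem loopFuel_two_zpow (emin j : ℤ) : loopFuel emin ((2 : ℚ) ^ j) = (j - emin).toNat + 1 := by
  have : Int.log 2 ((2 : ℚ) ^ j) = j := by exact_mod_cast Int.log_zpow (R := ℚ) (b := 2) (by norm_num) j
  rw [loopFuel, this]

/-- `n + 2 ≤ 2^M'` with `n ≥ 1` forces `M' ≥ 2` (so `2⁻ᴹ ≤ ¼`, as Theorem 3.5 / Lemma 4.3 need).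
[cite: RumpOgitaOishi2008, Lemma 4.2 (`M`)] -/
theorem two_le_of_add_two_le_two_pow {n M' : ℕ} (hn : 1 ≤ n) (h : n + 2 ≤ 2 ^ M') : 2 ≤ M' := by
  by_contra hlt
  have : 2 ^ M' ≤ 2 := (Nat.pow_le_pow_right (by norm_num) (by omega : M' ≤ 1)).trans (by norm_num)
  omega

/-- `2²ᴹ'eps ≤ 1`, i.e. `2M' ≤ p` in precision `p`, from the hypothesis `(2ᴹ)²·eps ≤ 1` on the computed
`2ᴹ = 2^M'`. [cite: RumpOgitaOishi2008, Lemma 4.2 (`2²ᴹeps ≤ 1`)] -/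
theorem two_mul_le_prec_of_sq_mul_u_le_one {M' : ℕ} (h : ((2 : ℚ) ^ M') ^ 2 * unitRoundoff p ≤ 1) :
    2 * M' ≤ p := by
  rw [two_pow_sq, unitRoundoff, mul_one_div, div_le_one (by positivity)] at h
  by_contra hlt
  exact absurd h (not_le.mpr (pow_lt_pow_right₀ (by norm_num) (by omega)))

/-! ### Lemma 4.2 for Algorithm 4.4 (with the restarts) -/

/-- The postcondition of the final `Transform` (Algorithm 4.4) on a vector of `n` floating-point numbers with
sum `s`: EITHER its results `[τ₁, τ₂, p′, σ]` satisfy the assertions (4.2)–(4.5) of Lemma 4.2 / (4.9), (4.10),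
(4.12) of Lemma 4.3 (`TransformSpec`, with parameter `M`), OR a restart `Transform(p′)` met the ZERO vector —
every part has been extracted, `s = t + τ + Σ p′ᵢ = 0` exactly — and returned `τ₁ = τ₂ = σ = 0`, `p′ = 0`
("if μ = 0, τ₁ = τ₂ = σ = 0, return"). In both cases the conclusions of Lemma 4.3 hold for
`res = fl(τ₁ + (τ₂ + Σ p′ᵢ))` (`faithful_of_finalPost_tree`). [cite: RumpOgitaOishi2008, Algorithm 4.4 / Lemma 4.2] -/
def FinalPost (p : ℕ) (emin : ℤ) (fl : ℚ → ℚ) (M : ℕ) (s : ℚ) (n : ℕ) (r : ℚ × ℚ × List ℚ × ℚ) : Prop :=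
  TransformSpec p emin fl M s n r.1 r.2.1 r.2.2.1 r.2.2.2 ∨
    (r.1 = 0 ∧ r.2.1 = 0 ∧ r.2.2.2 = 0 ∧ r.2.2.1.length = n ∧ (∀ x ∈ r.2.2.1, x = 0) ∧ s = 0)

/-- **LEMMA 4.2 for ALGORITHM 4.4, with the restarts** (induction on the restart budget). Let `p` be a
nonzero vector of `n` floating-point numbers, `n + 2 ∈ F`, and `(2ᴹ)²eps ≤ 1` for the computed
`2ᴹ = NextPowerTwo(n + 2)`. If the budget exceeds `⌈log₂ μ⌉ − emin` then the result satisfies `FinalPost` with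
`M = ⌈log₂(n + 2)⌉`: the first lines give `2ᴹ = 2^M'`, `M' ≥ ⌈log₂(n+2)⌉` (Theorem 3.7), `σ₀ = 2^(M'+K)` with
`2^K = NextPowerTwo(μ) ≥ μ`, so the loop invariant of Lemma 4.2 holds on entry (`max |pᵢ| ≤ μ ≤ 2⁻ᴹ'σ₀`,
`t = 0`); by `transformFinalLoop_spec` the loop either stops in a state satisfying Lemma 4.2 (with `M'`, a
fortiori with `⌈log₂(n+2)⌉`, eq. (4.5) being monotone), or hands a vector `p′` of floats with `Σ p′ᵢ = s` and
`max |p′ᵢ| ≤ epsσ₀ = 2^(M'+K-p)` to the restart — which is the zero vector (second alternative of `FinalPost`),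
or nonzero with `⌈log₂ μ′⌉ ≤ M' + K − p ≤ ⌈log₂ μ⌉ + 1 + M' − 2M' ≤ ⌈log₂ μ⌉ − 1` (`K ≤ ⌈log₂ μ⌉ + 1`,
`M' ≥ 2`), so the induction hypothesis applies with the smaller budget. Since `⌈log₂ μ′⌉ ≥ emin` throughout,
at most `⌈log₂ μ⌉ − emin` restarts occur: the algorithm terminates ("so that only basic floating-point
operations are necessary" — and finitely many of them). [cite: RumpOgitaOishi2008, Lemma 4.2 / Algorithm 4.4] -/
theorem transformFinalAux_spec (hfl : IsRoundNearest p emin fl) {n : ℕ}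
    (hn2 : IsFloat p emin ((n : ℚ) + 2)) (hMs : nextPowerTwo fl p ((n : ℚ) + 2) ^ 2 * unitRoundoff p ≤ 1) :
    ∀ (depth : ℕ) (xs : List ℚ), xs.length = n → (∀ x ∈ xs, IsFloat p emin x) → maxAbs xs ≠ 0 →
      (Int.clog 2 (maxAbs xs) - emin).toNat < depth →
      FinalPost p emin fl (Nat.clog 2 (n + 2)) xs.sum n (transformFinalAux fl p emin depth xs)
  | 0, _, _, _, _, hd => absurd hd (Nat.not_lt_zero _)
  | depth + 1, xs, hlen, hxs, hne, hd => by
      have hp : 1 ≤ p := one_le_prec_of_isFloat_ne_zero hn2 (by positivity)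
      -- `2ᴹ = NextPowerTwo(n + 2) = 2^M'`, `n + 2 ≤ 2^M'`, `⌈log₂(n+2)⌉ ≤ M'`, and `2M' ≤ p`
      have htwo : twoPowM fl p xs = nextPowerTwo fl p ((n : ℚ) + 2) := by rw [twoPowM, hlen]
      obtain ⟨M', hM', hnM', hcM', -⟩ := twoPowM_eq hp hfl (xs := xs) (by rw [hlen]; exact hn2)
      rw [hlen] at hnM' hcM'
      have h2M' : 2 * M' ≤ p := two_mul_le_prec_of_sq_mul_u_le_one (by rw [← hM', htwo]; exact hMs)
      -- `n ≥ 1` (the vector is nonzero), `M' ≥ 2`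
      have hn1 : 1 ≤ n := by
        rw [← hlen]
        cases xs with
        | nil => exact absurd rfl hne
        | cons _ _ => simp
      have hM'2 : 2 ≤ M' := two_le_of_add_two_le_two_pow hn1 hnM'
      -- `NextPowerTwo(μ) = 2^K ≥ μ`, `K ≤ ⌈log₂ μ⌉ + 1`, `⌈log₂ μ⌉ ≥ emin`; `σ₀ = 2^(M'+K)`
      obtain ⟨heminc, -⟩ := emin_le_clog_maxAbs hxs hne
      obtain ⟨K, hK, hμK, hcK, hKc⟩ := nextPowerTwo_maxAbs_eq hp hfl hxs hne
      have hσ₀ : sigmaStart fl p xs = (2 : ℚ) ^ ((M' : ℤ) + K) := sigmaStart_eq hp hfl hM' (by omega) hK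
      -- Lemma 4.2 for the loop, entered with `t = 0`, `σ₀ = 2^(M'+K)`, `max |pᵢ| ≤ μ ≤ 2^K = 2^-M' σ₀`
      have hL := transformFinalLoop_spec hp hfl h2M' hnM' xs.sum (loopFuel emin ((2 : ℚ) ^ ((M' : ℤ) + K)))
        0 ((M' : ℤ) + K) xs (by omega) (by rw [loopFuel_two_zpow]; push_cast; omega) hlen
        (fun x hx => ⟨hxs x hx, by
          rw [show (M' : ℤ) + K - M' = K by ring]; exact (abs_le_maxAbs hx).trans hμK⟩)
        (isFloat_zero p emin) (onGrid_zero _) (by simp)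
      rw [transformFinalAux, if_neg hne, hM', hσ₀]
      rcases hr : transformFinalLoop fl ((2 : ℚ) ^ M') (unitRoundoff p) ((2 : ℚ) ^ (emin + ↑p - 1))
          (loopFuel emin ((2 : ℚ) ^ ((M' : ℤ) + K))) 0 ((2 : ℚ) ^ ((M' : ℤ) + K)) xs with r | xs'
      · -- the loop stopped by the `until` condition: Lemma 4.2 with `M' ≥ ⌈log₂(n+2)⌉`, hence with `⌈log₂(n+2)⌉`
        rw [hr] at hL
        exact Or.inl (TransformSpec.of_le hcM' hL)
      · -- `t′ = 0`: restart on `p′` with `Σ p′ᵢ = s`, `max |p′ᵢ| ≤ epsσ₀ = 2^(M'+K-p)`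
        rw [hr] at hL
        obtain ⟨hlen', hxs', hs'⟩ := hL
        have hxs'F : ∀ x ∈ xs', IsFloat p emin x := fun x hx => (hxs' x hx).1
        dsimp only
        by_cases hne' : maxAbs xs' = 0
        · -- the restart meets the zero vector: `s = Σ p′ᵢ = 0`, results `τ₁ = τ₂ = σ = 0`, `p′ = 0`
          have hz := maxAbs_eq_zero_iff.mp hne'
          rw [transformFinalAux_of_maxAbs_eq_zero fl p emin hne' depth]
          exact Or.inr ⟨rfl, rfl, rfl, hlen', hz, by rw [hs']; exact List.sum_eq_zero hz⟩
        · -- a genuine restart: `emin ≤ ⌈log₂ μ′⌉ ≤ M' + K − p ≤ ⌈log₂ μ⌉ − 1`, the budget suffices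
          have hμ'le : maxAbs xs' ≤ (2 : ℚ) ^ ((M' : ℤ) + K - p) := by
            obtain ⟨y, hy, hyμ⟩ := exists_abs_eq_maxAbs hne'
            rw [← hyμ]
            have := (hxs' y hy).2
            rwa [u_mul_two_zpow] at this
          have hμ'pos : 0 < maxAbs xs' := lt_of_le_of_ne (maxAbs_nonneg xs') (Ne.symm hne')
          have hclog' : Int.clog 2 (maxAbs xs') ≤ (M' : ℤ) + K - p := by
            have h1 := Int.clog_mono_right (b := 2) hμ'pos hμ'le
            have h2 : Int.clog 2 ((2 : ℚ) ^ ((M' : ℤ) + K - p)) = (M' : ℤ) + K - p := by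
              have := Int.clog_zpow (R := ℚ) (b := 2) (by norm_num) ((M' : ℤ) + K - p); exact_mod_cast this
            rwa [h2] at h1
          obtain ⟨heminc', -⟩ := emin_le_clog_maxAbs hxs'F hne'
          have IH := transformFinalAux_spec hfl hn2 hMs depth xs' hlen' hxs'F hne' (by omega)
          rw [hs']
          exact IH

/-- **LEMMA 4.2 for ALGORITHM 4.4 (`Transform`, final version).** Let `p` be a nonzero vector of `n`
floating-point numbers with `n + 2 ∈ F` and `(2ᴹ)²eps ≤ 1` for `2ᴹ = NextPowerTwo(n + 2)` (under IEEE 754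
round-to-nearest-even this is the printed hypothesis `2²ᴹeps ≤ 1`, `M = ⌈log₂(n + 2)⌉`, see
`twoPowM_roundTiesEven`). Then Algorithm 4.4 stops, and its results `[τ₁, τ₂, p′, σ]` satisfy (4.2)–(4.5) with
`M = ⌈log₂(n + 2)⌉` — or a restart was invoked on the zero vector (`s = 0`, `τ₁ = τ₂ = σ = 0`, `p′ = 0`): `FinalPost`.
("Note that this may happen only" when `t + τ = 0`, and then `AccSum` still "computes res as a faithfully
rounded result".) [cite: RumpOgitaOishi2008, Lemma 4.2 / Algorithm 4.4] -/
theorem transformFinal_spec (hfl : IsRoundNearest p emin fl) {xs : List ℚ}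
    (hxs : ∀ x ∈ xs, IsFloat p emin x) (hne : maxAbs xs ≠ 0)
    (hn2 : IsFloat p emin ((xs.length : ℚ) + 2)) (hMs : twoPowM fl p xs ^ 2 * unitRoundoff p ≤ 1) :
    FinalPost p emin fl (Nat.clog 2 (xs.length + 2)) xs.sum xs.length (transformFinal fl p emin xs) :=
  transformFinalAux_spec hfl hn2 hMs _ xs rfl hxs hne (Nat.lt_succ_self _)

/-! ### §4: Algorithm 4.5 `AccSum` over the final `Transform` — Lemma 4.3, Proposition 4.6, Corollary 4.7 -/

/-- The conclusions of Lemma 4.3 from `FinalPost`, the inner sum `Σ p′ᵢ` evaluated in floating-point in ANY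
order (binary tree `t₃` on the leaves `p′`): `res = fl(τ₁ + (τ₂ + fl(Σ p′ᵢ)))` is a faithful rounding of `s`;
`res = 0 ⟹ τ₁ = τ₂ = 0, p′ = 0, s = 0`; `res ≠ 0 ⟹` (4.11). In the first alternative this is Lemma 4.3
(`faithful_of_transformSpec_tree`); in the second `res = fl(0 + fl(0 + 0)) = 0 = s`.
[cite: RumpOgitaOishi2008, Lemma 4.3 eqs. (4.11), (4.23) / Algorithm 4.4] -/
theorem faithful_of_finalPost_tree (hfl : IsRoundNearest p emin fl) {M : ℕ} (hM : 2 ≤ M) (h2M : 2 * M ≤ p)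
    {n : ℕ} (hn : 1 ≤ n) (hnM : n + 2 ≤ 2 ^ M) {s : ℚ} {r : ℚ × ℚ × List ℚ × ℚ}
    (H : FinalPost p emin fl M s n r) (t₃ : SumTree) (ht₃ : t₃.leaves = r.2.2.1) :
    IsFaithfulRounding p emin (fl (r.1 + fl (r.2.1 + t₃.eval fl))) s ∧
      (fl (r.1 + fl (r.2.1 + t₃.eval fl)) = 0 → r.1 = 0 ∧ r.2.1 = 0 ∧ (∀ x ∈ r.2.2.1, x = 0) ∧ s = 0) ∧
      (fl (r.1 + fl (r.2.1 + t₃.eval fl)) ≠ 0 → |s - fl (r.1 + fl (r.2.1 + t₃.eval fl))| <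
        2 * unitRoundoff p * (1 - 1 / 2 ^ (M + 1)) * ufp (fl (r.1 + fl (r.2.1 + t₃.eval fl)))) := by
  rcases H with H | ⟨h1, h2, -, -, hz, hs⟩
  · exact faithful_of_transformSpec_tree hfl hM h2M hn hnM H t₃ ht₃
  · have ht : t₃.eval fl = 0 := eval_eq_zero_of_leaves hfl t₃ (fun a ha => hz a (ht₃ ▸ ha))
    have hres : fl (r.1 + fl (r.2.1 + t₃.eval fl)) = 0 := by
      rw [h1, h2, ht, add_zero, fl_zero hfl, add_zero, fl_zero hfl]
    rw [hres, hs]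
    refine ⟨?_, fun _ => ⟨h1, h2, hz, rfl⟩, fun h => absurd rfl h⟩
    have := isFaithfulRounding_fl hfl (0 : ℚ)
    rwa [fl_zero hfl] at this

/-- On the zero vector (and on the empty one) `AccSum` (over Algorithm 4.4) returns `res = 0 = s`.
[cite: RumpOgitaOishi2008, Algorithm 4.4 ("if μ = 0") / Algorithm 4.5] -/
theorem accSumFinal_of_maxAbs_eq_zero (hfl : IsRoundNearest p emin fl) {xs : List ℚ} (h : maxAbs xs = 0) :
    accSumFinal fl p emin xs = 0 ∧ xs.sum = 0 := by
  have hz := maxAbs_eq_zero_iff.mp h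
  refine ⟨?_, List.sum_eq_zero hz⟩
  rw [accSumFinal, transformFinal_of_maxAbs_eq_zero fl p emin h]
  simp only [flSum_eq_zero hfl hz, zero_add, fl_eq_self hfl (isFloat_zero p emin)]

/-- **LEMMA 4.3 for ALGORITHMS 4.4 / 4.5.** Let `p` be a nonzero vector of `n` floating-point numbers,
`n + 2 ∈ F`, `(2ᴹ)²eps ≤ 1` for `2ᴹ = NextPowerTwo(n + 2)`, and `M = ⌈log₂(n + 2)⌉`. Then `res = AccSum(p)`
(Algorithm 4.5 over the final `Transform`) is a faithful rounding of `s = Σ pᵢ`; `res = 0 ⟹ τ₁ = τ₂ = 0`,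
`p′ = 0`, `s = 0` (4.23); and `res ≠ 0 ⟹ |s − res| < 2eps(1 − 2^(−M−1))ufp(res)` (4.11).
[cite: RumpOgitaOishi2008, Lemma 4.3 eqs. (4.11), (4.23) / Algorithm 4.4] -/
theorem accSumFinal_spec_of_maxAbs_ne_zero (hfl : IsRoundNearest p emin fl) {xs : List ℚ}
    (hxs : ∀ x ∈ xs, IsFloat p emin x) (hne : maxAbs xs ≠ 0)
    (hn2 : IsFloat p emin ((xs.length : ℚ) + 2)) (hMs : twoPowM fl p xs ^ 2 * unitRoundoff p ≤ 1) :
    IsFaithfulRounding p emin (accSumFinal fl p emin xs) xs.sum ∧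
      (accSumFinal fl p emin xs = 0 → (transformFinal fl p emin xs).1 = 0 ∧
        (transformFinal fl p emin xs).2.1 = 0 ∧ (∀ x ∈ (transformFinal fl p emin xs).2.2.1, x = 0) ∧
        xs.sum = 0) ∧
      (accSumFinal fl p emin xs ≠ 0 → |xs.sum - accSumFinal fl p emin xs| <
        2 * unitRoundoff p * (1 - 1 / 2 ^ (Nat.clog 2 (xs.length + 2) + 1)) *
          ufp (accSumFinal fl p emin xs)) := by
  have hnil : xs ≠ [] := by rintro rfl; exact hne rfl
  have hM : 2 ≤ Nat.clog 2 (xs.length + 2) := two_le_clog_length_add_two hnil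
  have hp : 1 ≤ p := one_le_prec_of_isFloat_ne_zero hn2 (by positivity)
  have hn : 1 ≤ xs.length := by
    cases xs with
    | nil => exact absurd rfl hnil
    | cons _ _ => simp
  have hnM : xs.length + 2 ≤ 2 ^ Nat.clog 2 (xs.length + 2) := Nat.le_pow_clog (by norm_num) _
  have h2M : 2 * Nat.clog 2 (xs.length + 2) ≤ p := by
    obtain ⟨M', hM', -, hcM', -⟩ := twoPowM_eq hp hfl hn2
    have := two_mul_le_prec_of_sq_mul_u_le_one (p := p) (M' := M') (by rw [← hM']; exact hMs)
    omega
  have H := transformFinal_spec hfl hxs hne hn2 hMs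
  have hlen' : (transformFinal fl p emin xs).2.2.1.length = xs.length := by
    rcases H with H | ⟨-, -, -, h, -, -⟩
    · exact H.length_eq
    · exact h
  have hnil' : (transformFinal fl p emin xs).2.2.1 ≠ [] := by
    intro h
    rw [h, List.length_nil] at hlen'
    omega
  obtain ⟨t₃, ht₃, hft⟩ := exists_tree_flSum fl hnil'
  have := faithful_of_finalPost_tree hfl hM h2M hn hnM H t₃ ht₃
  rw [accSumFinal, hft]
  exact this

/-- **PROPOSITION 4.6 for ALGORITHM 4.4 / 4.5 (every rounding to nearest).** Let `p` be a vector of `n`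
floating-point numbers with `n + 2 ∈ F` and `(2ᴹ)²eps ≤ 1` for the computed `2ᴹ = NextPowerTwo(n + 2)`. Then
`res = AccSum(p)` is a faithful rounding of `s = Σ pᵢ` (for the zero or empty vector `res = 0 = s`).
[cite: RumpOgitaOishi2008, Proposition 4.6 / Algorithm 4.4] -/
theorem isFaithfulRounding_accSumFinal (hfl : IsRoundNearest p emin fl) {xs : List ℚ}
    (hxs : ∀ x ∈ xs, IsFloat p emin x) (hn2 : IsFloat p emin ((xs.length : ℚ) + 2))
    (hMs : twoPowM fl p xs ^ 2 * unitRoundoff p ≤ 1) :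
    IsFaithfulRounding p emin (accSumFinal fl p emin xs) xs.sum := by
  by_cases hμ : maxAbs xs = 0
  · obtain ⟨h1, h2⟩ := accSumFinal_of_maxAbs_eq_zero hfl hμ (p := p)
    rw [h1, h2]
    have := isFaithfulRounding_fl hfl (0 : ℚ)
    rwa [fl_eq_self hfl (isFloat_zero p emin)] at this
  · exact (accSumFinal_spec_of_maxAbs_ne_zero hfl hxs hμ hn2 hMs).1

/-- **The printed hypotheses imply the model's, in IEEE 754 arithmetic.** Under rounding to nearest, ties to
even, with `emin ≤ 0`: if `2²ᴹeps ≤ 1` for `M = ⌈log₂(n + 2)⌉` then `n + 2 ∈ F` (`n + 2 ≤ 2ᴹ < eps⁻¹`) and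
`NextPowerTwo(n + 2) = 2ᴹ` (Theorem 3.7, `p ≥ 2M ≥ 2`), so `(NextPowerTwo(n+2))²eps = 2²ᴹeps ≤ 1`.
[cite: RumpOgitaOishi2008, Proposition 4.6 / Theorem 3.7 / Algorithm 4.4] -/
theorem hyps_of_roundTiesEven (hemin : emin ≤ 0) {xs : List ℚ} (h2M : 2 * Nat.clog 2 (xs.length + 2) ≤ p) :
    IsFloat p emin ((xs.length : ℚ) + 2) ∧ twoPowM (roundTiesEven p emin) p xs ^ 2 * unitRoundoff p ≤ 1 := by
  have hM1 := one_le_clog_length_add_two xs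
  have hnM : xs.length + 2 ≤ 2 ^ Nat.clog 2 (xs.length + 2) := Nat.le_pow_clog (by norm_num) _
  have hlt : xs.length + 2 < 2 ^ p := lt_of_le_of_lt hnM (Nat.pow_lt_pow_right (by norm_num) (by omega))
  have hn2 : IsFloat p emin ((xs.length : ℚ) + 2) := isFloat_length_add_two hemin hlt
  refine ⟨hn2, ?_⟩
  rw [twoPowM_roundTiesEven (by omega) hn2, two_pow_sq, unitRoundoff, mul_one_div, div_le_one (by positivity)]
  exact pow_le_pow_right₀ (by norm_num) h2M

/-- **PROPOSITION 4.6 as printed, for the final version (Algorithms 4.4 / 4.5) in IEEE 754 arithmetic**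
(rounding to nearest, ties to even; gradual underflow, `emin ≤ 0`): let `p` be a vector of `n` floating-point
numbers, `M = ⌈log₂(n + 2)⌉` and `2²ᴹeps ≤ 1`; then `res = AccSum(p)` is a faithful rounding of `s = Σ pᵢ`.
[cite: RumpOgitaOishi2008, Proposition 4.6] -/
theorem isFaithfulRounding_accSumFinal_roundTiesEven (hemin : emin ≤ 0) {xs : List ℚ}
    (hxs : ∀ x ∈ xs, IsFloat p emin x) (h2M : 2 * Nat.clog 2 (xs.length + 2) ≤ p) :
    IsFaithfulRounding p emin (accSumFinal (roundTiesEven p emin) p emin xs) xs.sum := by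
  have hp : 1 ≤ p := le_trans (one_le_clog_length_add_two xs) (by omega)
  obtain ⟨hn2, hMs⟩ := hyps_of_roundTiesEven hemin h2M (p := p)
  exact isFaithfulRounding_accSumFinal (isRoundNearest_roundTiesEven hp) hxs hn2 hMs

/-- **PROPOSITION 4.6 for the final version under ANY rounding to nearest** (arbitrary tie rule, `emin ≤ 0`):
one more bit suffices — if `2^(2(M+1))eps ≤ 1`, `M = ⌈log₂(n + 2)⌉`, then `res = AccSum(p)` is a faithful
rounding of `s` (`NextPowerTwo(n + 2) ≤ 2^(M+1)` by the Remark after Theorem 3.7).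
[cite: RumpOgitaOishi2008, Proposition 4.6 / Theorem 3.7 (Remark)] -/
theorem isFaithfulRounding_accSumFinal_of_isRoundNearest (hfl : IsRoundNearest p emin fl) (hemin : emin ≤ 0)
    {xs : List ℚ} (hxs : ∀ x ∈ xs, IsFloat p emin x) (h2M1 : 2 * (Nat.clog 2 (xs.length + 2) + 1) ≤ p) :
    IsFaithfulRounding p emin (accSumFinal fl p emin xs) xs.sum := by
  have hp : 1 ≤ p := by omega
  have hnM : xs.length + 2 ≤ 2 ^ Nat.clog 2 (xs.length + 2) := Nat.le_pow_clog (by norm_num) _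
  have hlt : xs.length + 2 < 2 ^ p := lt_of_le_of_lt hnM (Nat.pow_lt_pow_right (by norm_num) (by omega))
  have hn2 : IsFloat p emin ((xs.length : ℚ) + 2) := isFloat_length_add_two hemin hlt
  obtain ⟨M', hM', -, -, hM'c⟩ := twoPowM_eq hp hfl hn2
  refine isFaithfulRounding_accSumFinal hfl hxs hn2 ?_
  rw [hM', two_pow_sq, unitRoundoff, mul_one_div, div_le_one (by positivity)]
  exact pow_le_pow_right₀ (by norm_num) (by omega)

/-- **PROPOSITION 4.6 (final version) in the vocabulary of Boldo–Jeannerod–Melquiond–Muller**: `AccSum(p)` is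
a faithful rounding (`IsFaithful`: it is `RD(s)` or `RU(s)`) of `s = Σ pᵢ`. [cite: RumpOgitaOishi2008, Proposition 4.6] -/
theorem isFaithful_accSumFinal (hfl : IsRoundNearest p emin fl) {xs : List ℚ}
    (hxs : ∀ x ∈ xs, IsFloat p emin x) (hn2 : IsFloat p emin ((xs.length : ℚ) + 2))
    (hMs : twoPowM fl p xs ^ 2 * unitRoundoff p ≤ 1) :
    IsFaithful p emin xs.sum (accSumFinal fl p emin xs) :=
  isFaithfulRounding_iff_isFaithful.mp (isFaithfulRounding_accSumFinal hfl hxs hn2 hMs)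

/-- **LEMMA 4.3, eq. (4.11)** for the final version: if `res ≠ 0` then `|s − res| < 2eps(1 − 2^(−M−1))ufp(res)`,
`M = ⌈log₂(n + 2)⌉`. [cite: RumpOgitaOishi2008, Lemma 4.3 eq. (4.11)] -/
theorem abs_sum_sub_accSumFinal_lt (hfl : IsRoundNearest p emin fl) {xs : List ℚ}
    (hxs : ∀ x ∈ xs, IsFloat p emin x) (hn2 : IsFloat p emin ((xs.length : ℚ) + 2))
    (hMs : twoPowM fl p xs ^ 2 * unitRoundoff p ≤ 1) (hres : accSumFinal fl p emin xs ≠ 0) :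
    |xs.sum - accSumFinal fl p emin xs| <
      2 * unitRoundoff p * (1 - 1 / 2 ^ (Nat.clog 2 (xs.length + 2) + 1)) * ufp (accSumFinal fl p emin xs) := by
  by_cases hμ : maxAbs xs = 0
  · exact absurd (accSumFinal_of_maxAbs_eq_zero hfl hμ (p := p)).1 hres
  · exact (accSumFinal_spec_of_maxAbs_ne_zero hfl hxs hμ hn2 hMs).2.2 hres

/-- **COROLLARY 4.7 (i)** for the final version: if `s = Σ pᵢ ∈ F` then `res = s`.
[cite: RumpOgitaOishi2008, Corollary 4.7] -/
theorem accSumFinal_eq_sum_of_isFloat_sum (hfl : IsRoundNearest p emin fl) {xs : List ℚ}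
    (hxs : ∀ x ∈ xs, IsFloat p emin x) (hn2 : IsFloat p emin ((xs.length : ℚ) + 2))
    (hMs : twoPowM fl p xs ^ 2 * unitRoundoff p ≤ 1) (hs : IsFloat p emin xs.sum) :
    accSumFinal fl p emin xs = xs.sum :=
  (isFaithfulRounding_accSumFinal hfl hxs hn2 hMs).eq_of_isFloat hs

/-- **COROLLARY 4.7 (ii)** for the final version: `res = 0 ⟺ s = 0` — the point of the check for zero is that
this now comes with `τ₁ = τ₂ = 0`, `p′ = 0` whichever way `res = 0` arises (`accSumFinal_spec_of_maxAbs_ne_zero`).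
[cite: RumpOgitaOishi2008, Corollary 4.7 / Lemma 4.3 eq. (4.23)] -/
theorem accSumFinal_eq_zero_iff (hfl : IsRoundNearest p emin fl) {xs : List ℚ}
    (hxs : ∀ x ∈ xs, IsFloat p emin x) (hn2 : IsFloat p emin ((xs.length : ℚ) + 2))
    (hMs : twoPowM fl p xs ^ 2 * unitRoundoff p ≤ 1) :
    accSumFinal fl p emin xs = 0 ↔ xs.sum = 0 := by
  constructor
  · intro h
    by_cases hμ : maxAbs xs = 0
    · exact (accSumFinal_of_maxAbs_eq_zero hfl hμ (p := p)).2
    · exact ((accSumFinal_spec_of_maxAbs_ne_zero hfl hxs hμ hn2 hMs).2.1 h).2.2.2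
  · intro hs
    have h0 : IsFloat p emin xs.sum := by rw [hs]; exact isFloat_zero p emin
    rw [accSumFinal_eq_sum_of_isFloat_sum hfl hxs hn2 hMs h0, hs]

/-- **COROLLARY 4.7 (iii) for any faithful rounding of a sum of floats**: if `res ∈ □(Σ pᵢ)` lies in the
underflow range, `|res| ≤ ½eps⁻¹eta`, then `res = Σ pᵢ` exactly — the neighbours of `res` are `res ± eta`
(Lemma 2.2), faithfulness puts `s` strictly between them, and `s − res ∈ etaℤ`.
[cite: RumpOgitaOishi2008, Corollary 4.7 (proof)] -/
theorem IsFaithfulRounding.eq_sum_of_abs_le (hp : 1 ≤ p) {res : ℚ} {xs : List ℚ}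
    (hF : IsFaithfulRounding p emin res xs.sum) (hxs : ∀ x ∈ xs, IsFloat p emin x)
    (hU : |res| ≤ (2 : ℚ) ^ (emin + p - 1)) : res = xs.sum := by
  have hresF : IsFloat p emin res := hF.isFloat
  obtain ⟨⟨hpF, hplt, -⟩, ⟨hsF, hslt, -⟩⟩ := isPred_sub_eta_and_isSucc_add_eta hp hresF hU
  have h1 : res - (2 : ℚ) ^ emin < xs.sum := hF.2.1 _ hpF hplt
  have h2 : xs.sum < res + (2 : ℚ) ^ emin := hF.2.2 _ hsF hslt
  have hg : OnGrid ((2 : ℚ) ^ emin) (xs.sum - res) :=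
    (onGrid_list_sum (fun x hx => onGrid_eta_of_isFloat (hxs x hx))).sub (onGrid_eta_of_isFloat hresF)
  by_contra hne
  have hne' : xs.sum - res ≠ 0 := sub_ne_zero.mpr (Ne.symm hne)
  have h3 := two_zpow_le_abs_of_onGrid hg hne'
  have h4 : |xs.sum - res| < (2 : ℚ) ^ emin := abs_sub_lt_iff.mpr ⟨by linarith, by linarith⟩
  linarith

/-- **COROLLARY 4.7 (iii)** for the final version: `|res| ≤ ½eps⁻¹eta ⟹ res = s`.
[cite: RumpOgitaOishi2008, Corollary 4.7] -/
theorem accSumFinal_eq_sum_of_abs_le (hfl : IsRoundNearest p emin fl) {xs : List ℚ}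
    (hxs : ∀ x ∈ xs, IsFloat p emin x) (hn2 : IsFloat p emin ((xs.length : ℚ) + 2))
    (hMs : twoPowM fl p xs ^ 2 * unitRoundoff p ≤ 1)
    (hU : |accSumFinal fl p emin xs| ≤ (2 : ℚ) ^ (emin + p - 1)) : accSumFinal fl p emin xs = xs.sum :=
  (isFaithfulRounding_accSumFinal hfl hxs hn2 hMs).eq_sum_of_abs_le
    (one_le_prec_of_isFloat_ne_zero hn2 (by positivity)) hxs hU

/-- **COROLLARY 4.7 (iv) for any faithful rounding** `res ∈ □(s)` with `res = 0 ⟺ s = 0`: `sign(res) = sign(s)`.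
[cite: RumpOgitaOishi2008, Corollary 4.7 / eq. (2.26)] -/
theorem IsFaithfulRounding.pos_iff_and_neg_iff {res s : ℚ} (hF : IsFaithfulRounding p emin res s)
    (hz : res = 0 ↔ s = 0) : (0 < res ↔ 0 < s) ∧ (res < 0 ↔ s < 0) := by
  obtain ⟨h1, h2, -⟩ := hF.sign
  refine ⟨⟨fun h => ?_, fun h => ?_⟩, ⟨fun h => ?_, fun h => ?_⟩⟩
  · by_contra hle
    exact absurd (h2 (not_lt.mp hle)) (not_le.mpr h)
  · exact lt_of_le_of_ne (h1 h.le) (fun h0 => absurd (hz.mp h0.symm) h.ne')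
  · by_contra hle
    exact absurd (h1 (not_lt.mp hle)) (not_le.mpr h)
  · exact lt_of_le_of_ne (h2 h.le) (fun h0 => absurd (hz.mp h0) h.ne)

/-- **COROLLARY 4.7 (iv)** for the final version: `sign(res) = sign(s)`. [cite: RumpOgitaOishi2008, Corollary 4.7] -/
theorem accSumFinal_pos_iff_and_neg_iff (hfl : IsRoundNearest p emin fl) {xs : List ℚ}
    (hxs : ∀ x ∈ xs, IsFloat p emin x) (hn2 : IsFloat p emin ((xs.length : ℚ) + 2))
    (hMs : twoPowM fl p xs ^ 2 * unitRoundoff p ≤ 1) :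
    (0 < accSumFinal fl p emin xs ↔ 0 < xs.sum) ∧ (accSumFinal fl p emin xs < 0 ↔ xs.sum < 0) :=
  (isFaithfulRounding_accSumFinal hfl hxs hn2 hMs).pos_iff_and_neg_iff (accSumFinal_eq_zero_iff hfl hxs hn2 hMs)

end Literature.ComputerArithmetic.RumpOgitaOishi2008
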